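import Summits.QuantumFields.YangMills.Theorems.BalabanUVNodesN15TwoGridDressedZeroOrderNoFit
import Summits.QuantumFields.YangMills.Theorems.BalabanUVNodesN15BackgroundLayerByName
import Summits.QuantumFields.YangMills.Theorems.BalabanUVNodesN15VectorPieceBackground
import HarnessLib

/-!
# N15 (NE2) — PROGRAMME M «MEAN-ZERO MULTIPLIERS», part M-E: `T4EtaRate.NE2PlusOperator` BY NAME WITH `Reg335 :=` THE (3.35) SUP LETTER ALONE — THE BACKGROUND
# CARRIER WITHOUT AN OSCILLATION LETTER, background block LIVE, size guard LIVE (n15-b's `…BackgroundLayerByName` §1–§4 with `FibreOsc` struck from (3.35))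

WHO ∕ WHEN.  Cell `pub-ymgap`, seat `pub-ymgap-dag-n15-a` (KNIT-BY-NAME seat of Track-A DAG node N15 = NE2, g24); `--kind proof --supports stmt-QuantumFields-27366 --as helper` (K3⁸;
count-neutral).  Over part M-D `…TwoGridDressedZeroOrderNoFit` (★★ `hasMaj_idef_bgProp_of_divAdj`), n15-b `…BackgroundLayerByName` (`fineGeo`, `blockAvg_zero`, `bgOps`, `one_le_pref4`,
`abs_le_iSup_abs`; through it `opGeo`, `opFamily`, `etaRateIneq342_of_hasMaj`, `rateFactor_opGeo`, `bgProp`, `inv_one_sub_le_two`) and -a part 27 `…VectorPieceBackground` (`unitTorusGeoS`,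
`rateWeight_unitTorusGeoS`) BY NAME; nothing in the tree is modified.
WHY.  n15-b's by-name theorem `ne2PlusOperator_background` (and every later background-LIVE `NE2PlusOperator` of the lineage) reads (3.35) on the zeroth-order coefficient carrier as the
LETTER PAIR «sup + within-block oscillation `FibreOsc π c′ (c·M·α₀·θ)`»; for the zeroth-order coefficient of (3.52) the oscillation letter is (3.36)-strength (M-A's header).  THIS FILE
re-issues the by-name statement on a carrier whose `Reg335` IS THE SUP LETTER ALONE: entry 0 (the constructed background-dependent pair `𝔇(X′(c′), X(blockAvg c′))`) is bounded by M-D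
from the `U ≡ 1` letters INCLUDING the fine piece's source-divergence letters («G∇*», (1.110) entry 2); entries 1–3 are the consumer's operators with displayed majorants EXACTLY as in
n15-b §4 (their zeroth-order-dressed versions meet the mixed letter «∇G∇*», n15-c's by-parts road — not here).
WHAT ([folklore] bookkeeping; 4 plumbing `def`s).  §10 `coeffBgSup X′ M` (`Cfg := X′ → ℝ`, `Reg335 c α₀ c′ := ∀ x′, |c′ x′| ≤ c·M·α₀`, `Reg336` the same), `bgPairingSup` ∕ `bgInstanceSup`
(King torus carriers `unitTorusGeoS L k M M_sz`, King's pairing, `avg := blockAvg`), `bgInstanceSup_gf_M` (the guard reads `M_sz`), `bgFamilySup` (`opFamily` of n15-b's `bgOps`).  §11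
`supConst`, ★★ `hasMaj_entry0_supOnly` (entry 0 under the guard from M-D: letters `(β, δ, m₀θ, C₁)`, `(L^k)⁻¹ ≤ θ`), ★★ `etaRateIneq342_supOnly` (per index, explicit `(B₀, δ₀)`).  §12 ★★★
`ne2PlusOperator_supOnly`: for ANY family of King-torus data with UNIFORM `U ≡ 1` letters `β·e^{−δd}` (both pieces), `m₀θ_i·e^{−δd}` (η-defect), `C₁·e^{−δd}` (fine «G∇*», every direction)
and entries 1–3 majorants `B₃θ_i·e^{−ρ₃d}`, rates `(L^{k_i})⁻¹ ≤ θ_i ≤ (L^{k_i})^{−γ}`: `NE2PlusOperator c₃₅ (bgInstanceSup …) (bgFamilySup …)` with `M₅ = 1`, `a₀ = (2c₃₅(βc_r + 1))⁻¹`,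
`B₀ = max(supConst, B₃) + 1`, `δ₀ = min(δ − σ, ρ₃)` — (3.35) CONSUMED AS ITS SUP LETTER ONLY.
HONEST FRAMING ∕ LIMITS.  Bookkeeping over hypothesis-shaped `U ≡ 1` data (inhabited for Bałaban's `(Δ′_a⁻¹, Δ_a⁻¹)` by M-D §9 for entry 0; entries 1–3 DISPLAYED — for the zeroth-order
dressing they are NOT discharged here); scalar zeroth-order species, linearised transport (C3), `U ≡ 1` torus MODEL carriers; nothing of [B5]∕[B6]∕[B9] asserted; NE2⁺ NOT printed ∕ proved;
no statement of record touched; N15 NOT discharged; K3⁸ OPEN; counts UNMOVED (typed 28∕28 · discharged 5∕27); one finite torus pair per index — NOT infinite volume ∕ OS ∕ mass gap ∕ Clay.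
-/

noncomputable section

open scoped BigOperators
open Finset

namespace Summit.QuantumFields.YangMills.BalabanUVNodes.N15.TwoGrid

open Literature.MathematicalPhysics.QuantumFieldTheory.Balaban1983to89
open Literature.MathematicalPhysics.QuantumFieldTheory.Balaban1983to89.B11SectG (BlockNorm HasMaj RowSum)
open Literature.MathematicalPhysics.QuantumFieldTheory.Balaban1983to89.T4EtaRate (PairedInstance EtaPairing EtaRateIneq342 NE2PlusOperator rateFactor)
open Literature.MathematicalPhysics.QuantumFieldTheory.Balaban1983to89.T4EtaRateDefect (idef rateWeight)
open Literature.MathematicalPhysics.QuantumFieldTheory.Balaban1983to89.T4EtaRateCoeffDefect (pull pull_apply blockAvg)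
open Literature.MathematicalPhysics.QuantumFieldTheory.Balaban1983to89.B9SectDSup (inv_one_sub_le_two)
open Literature.MathematicalPhysics.QuantumFieldTheory.Balaban1983to89.B5Prop11Plancherel (Tor fine)
open Literature.MathematicalPhysics.QuantumFieldTheory.King1986.Torus (blockOf tdistT tdistT_nonneg)
open Literature.MathematicalPhysics.QuantumFieldTheory.Balaban1983to89.B6UnitTorusCarrier (unitTorusGeo rowSum_unitTorusGeo)
open Summit.QuantumFields.YangMills.BalabanUVNodes.N15.VectorPiece (blkFine kingPrV blkFine_comp_kingPrV unitTorusGeoS rateWeight_unitTorusGeoS)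
open Summit.QuantumFields.YangMills.BalabanUVNodes.N15.OperatorReadout (opGeo opFamily opGeo_len rateFactor_opGeo etaRateIneq342_of_hasMaj)
open Summit.QuantumFields.YangMills.BalabanUVNodes.N15.BackgroundLayer (bgProp fineGeo blockAvg_zero bgOps one_le_pref4 abs_le_iSup_abs)

variable {d : ℕ}

/-! ## §10 The sup-only coefficient carrier, the pairing and the realised instances on the King torus carriers -/

section Carrier

/-- **THE COEFFICIENT BACKGROUND CARRIER WITH THE (3.35) SUP LETTER ALONE**: configurations are fine coefficient fields `c′ : X′ → ℝ` (the zeroth-order species `V′ = M_{c′}`), `one := 0`,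
`mul := (+)`, and `Reg335 c α₀ c′ := ∀ x′, |c′ x′| ≤ c·M·α₀` — NO oscillation letter (n15-b's `coeffBg` with `FibreOsc` struck); `Reg336` the same; (3.37)–(3.38) inert.
[cite: Balaban1985BackgroundPropagators, (3.35) p.396 («|A| < O(1)Mα₀(L^jη)^{−1}»: the sup letter, shape)] -/
def coeffBgSup (X' : Type) (M : ℝ) : B9.Backgrounds where
  Cfg := X' → ℝ
  one := 0
  mul := fun c₁ c₂ => c₁ + c₂
  Reg335 := fun c α₀ c' => ∀ x', |c' x'| ≤ c * M * α₀
  Reg336 := fun c α₀ c' => ∀ x', |c' x'| ≤ c * M * α₀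
  Cplx337 := fun _ _ _ => True
  Cplx338 := fun _ _ _ => True

/-- Unfolding of the carrier's (3.35): the sup letter. [folklore] -/
theorem reg335_coeffBgSup_iff (X' : Type) (M c α₀ : ℝ) (c' : X' → ℝ) : (coeffBgSup X' M).Reg335 c α₀ c' ↔ ∀ x', |c' x'| ≤ c * M * α₀ := Iff.rfl

variable {L : ℕ} [NeZero L] (M : Fin (d + 1) → ℕ) [∀ μ, NeZero (M μ)] (k m : ℕ) (Msz : ℝ)

/-- THE η-PAIRING over the sup-only carriers on the King torus (sized carrier `unitTorusGeoS L k M M_sz`, King blocks, King's pairing of the `η′ = L^{−m}η` bonds; `avg := blockAvg`,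
`τ := pull`; NOT PRINTED data — n15-b's `bgPairing`, carriers replaced). [cite: King1986, p.664 (convention before Prop. 3.8)] -/
def bgPairingSup : EtaPairing (opGeo (unitTorusGeoS L k M Msz) (Tor (fine (L ^ k) M) × Fin (d + 1)) (blkFine L k M))
    (fineGeo (unitTorusGeoS L k M Msz) (Tor (fine (L ^ m * L ^ k) M) × Fin (d + 1)) (blkFine L k M ∘ kingPrV L k m M) m)
    (coeffBgSup (Tor (fine (L ^ k) M) × Fin (d + 1)) Msz) (coeffBgSup (Tor (fine (L ^ m * L ^ k) M) × Fin (d + 1)) Msz) where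
  n := m
  k_eq := rfl
  L_eq := rfl
  M_eq := rfl
  eta_eq := by
    show ((L : ℝ) ^ k)⁻¹ * ((L : ℝ) ^ m)⁻¹ * (L : ℝ) ^ m = ((L : ℝ) ^ k)⁻¹
    rw [mul_assoc, inv_mul_cancel₀ (pow_ne_zero _ (Nat.cast_ne_zero.mpr (NeZero.ne L))), mul_one]
  ι := fun y => y
  scale_ι := fun _ => rfl
  dist_ι := fun _ _ => rfl
  τ := fun lam => pull (kingPrV L k m M) lam
  suppIn_τ := fun _ _ h x' hx' => h (kingPrV L k m M x') hx'
  supNorm_τ := fun lam => by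
    show (⨆ x', |lam (kingPrV L k m M x')|) ≤ ⨆ x, |lam x|
    exact Real.iSup_le (fun x' => abs_le_iSup_abs lam (kingPrV L k m M x')) (Real.iSup_nonneg fun x => abs_nonneg _)
  avg := fun c' => blockAvg (kingPrV L k m M) c'
  avg_one := blockAvg_zero (kingPrV L k m M)

/-- THE REALISED PAIRED INSTANCE over the sup-only carriers. [cite: Balaban1985BackgroundPropagators, Thm 3.14 pp.426–427 (typing template)] -/
def bgInstanceSup : PairedInstance :=
  ⟨opGeo (unitTorusGeoS L k M Msz) (Tor (fine (L ^ k) M) × Fin (d + 1)) (blkFine L k M),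
    fineGeo (unitTorusGeoS L k M Msz) (Tor (fine (L ^ m * L ^ k) M) × Fin (d + 1)) (blkFine L k M ∘ kingPrV L k m M) m,
    coeffBgSup (Tor (fine (L ^ k) M) × Fin (d + 1)) Msz, coeffBgSup (Tor (fine (L ^ m * L ^ k) M) × Fin (d + 1)) Msz, bgPairingSup M k m Msz⟩

/-- THE GUARD IS LIVE: the fine geometry's [B9] size parameter IS `M_sz`. [folklore] -/
theorem bgInstanceSup_gf_M : (bgInstanceSup (L := L) M k m Msz).gf.M = Msz := rfl

/-- THE KERNEL FAMILY over the sup-only carrier: n15-b's four entry operators `bgOps` (entry 0 = `𝔇(bgProp G′ c′, bgProp G (blockAvg π c′))`, entries 1–3 the consumer's `T`), read through `opFamily`.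
[cite: Balaban1985BackgroundPropagators, (3.42) p.397 (the four sup entries: shape)] -/
def bgFamilySup (G : (Tor (fine (L ^ k) M) × Fin (d + 1) → ℝ) →ₗ[ℝ] (Tor (fine (L ^ k) M) × Fin (d + 1) → ℝ))
    (G' : (Tor (fine (L ^ m * L ^ k) M) × Fin (d + 1) → ℝ) →ₗ[ℝ] (Tor (fine (L ^ m * L ^ k) M) × Fin (d + 1) → ℝ))
    (T : Fin 3 → (Tor (fine (L ^ m * L ^ k) M) × Fin (d + 1) → ℝ) → ((Tor (fine (L ^ k) M) × Fin (d + 1) → ℝ) →ₗ[ℝ] (Tor (fine (L ^ m * L ^ k) M) × Fin (d + 1) → ℝ))) :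
    B9.KernelFamily (bgInstanceSup (L := L) M k m Msz).gc (bgInstanceSup (L := L) M k m Msz).Bf :=
  show B9.KernelFamily (opGeo (unitTorusGeoS L k M Msz) (Tor (fine (L ^ k) M) × Fin (d + 1)) (blkFine L k M)) (coeffBgSup (Tor (fine (L ^ m * L ^ k) M) × Fin (d + 1)) Msz) from
    opFamily (g := unitTorusGeoS L k M Msz) (B := coeffBgSup (Tor (fine (L ^ m * L ^ k) M) × Fin (d + 1)) Msz) (blkFine L k M) (blkFine L k M ∘ kingPrV L k m M)
      (bgOps (kingPrV L k m M) G G' T)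

end Carrier

/-! ## §11 Per index: entry 0 under the guard (from M-D), and `EtaRateIneq342` with explicit constants -/

section PerIndex

/-- THE EXPLICIT OUTPUT CONSTANT of entry 0 (M-D's constant with `q ≤ ½`, `r ≤ c₃₅a₀`, `(L^k)⁻¹ ≤ θ`): `2·(m₀c_r + m₀c_r(c₃₅a₀)2β + 2(d+1)(c₃₅a₀)C₁(2β)c_r)`. [folklore] -/
def supConst (d : ℕ) (β cr m₀ C₁ c35 a₀ : ℝ) : ℝ := (m₀ * cr + m₀ * cr * (c35 * a₀ * (β * 2)) + 2 * (d + 1) * (c35 * a₀) * C₁ * (β * 2) * cr) * 2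

/-- Non-negativity of the output constant. [folklore] -/
theorem supConst_nonneg {β cr m₀ C₁ c35 a₀ : ℝ} (hβ : 0 ≤ β) (hcr : 0 ≤ cr) (hm₀ : 0 ≤ m₀) (hC₁ : 0 ≤ C₁) (hc35 : 0 ≤ c35) (ha₀ : 0 ≤ a₀) : 0 ≤ supConst d β cr m₀ C₁ c35 a₀ := by
  unfold supConst; positivity

variable {L : ℕ} [NeZero L] (M : Fin (d + 1) → ℕ) [∀ μ, NeZero (M μ)] (k m : ℕ)

/-- ★★ **ENTRY 0 UNDER THE GUARD, THE SUP LETTER READ OFF `Reg335`, NO OSCILLATION LETTER.**  King torus carriers with the (2.61) row sum at `σ ≥ 0` (constant `c_r`); `U ≡ 1` pieces `G`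
(coarse), `G′` (fine) `≤ β·e^{−δd}`, η-defect `𝔇(G′, G) ≤ m₀θ·e^{−δd}`, fine source-divergence letters `G′∘ρ′(n′(s_κ⁻¹−1)) ≤ C₁·e^{−δd}`; `σ ≤ δ`; guard data `c₃₅ > 0`, `a₀ ≥ 0` with
`β(c₃₅a₀)c_r ≤ ½`, `M_sz ≥ 1`, `α₀ > 0`, `M_sz·α₀ ≤ a₀`; rate `(L^k)⁻¹ ≤ θ`; a configuration with `(coeffBgSup _ M_sz).Reg335 c₃₅ α₀ c′`.  Then
`𝔇(bgProp G′ c′, bgProp G (blockAvg π c′)) ≤ supConst·θ·e^{−(δ−σ)d}`. [cite: Balaban1985BackgroundPropagators, Thm 3.1 p.397 (quantifier template: M ≥ M₅, Mα₀ ≤ a₀, (3.35)); (3.63)–(3.65) pp.402–403 (mechanism)] -/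
theorem hasMaj_entry0_supOnly {σ cr : ℝ} (hσ : 0 ≤ σ) (hcr : 0 ≤ cr) (hrow : RowSum (unitTorusGeo L k M) σ cr) {δ β m₀ θ C₁ c35 a₀ Msz α₀ : ℝ} (hσδ : σ ≤ δ) (hβ : 0 ≤ β)
    (hm₀ : 0 ≤ m₀) (hθ : 0 ≤ θ) (hkθ : (((L ^ k : ℕ) : ℝ))⁻¹ ≤ θ) (hC₁ : 0 ≤ C₁) (hc35 : 0 < c35) (ha₀ : 0 ≤ a₀) (hq : β * (c35 * a₀) * cr ≤ 1 / 2) (hM : 1 ≤ Msz)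
    (hα₀ : 0 < α₀) (hMα : Msz * α₀ ≤ a₀)
    {G : (Tor (fine (L ^ k) M) × Fin (d + 1) → ℝ) →ₗ[ℝ] (Tor (fine (L ^ k) M) × Fin (d + 1) → ℝ)}
    {G' : (Tor (fine (L ^ m * L ^ k) M) × Fin (d + 1) → ℝ) →ₗ[ℝ] (Tor (fine (L ^ m * L ^ k) M) × Fin (d + 1) → ℝ)}
    (hG : HasMaj (BlockNorm.ofBlocks (unitTorusGeo L k M) (blkFine L k M)) (BlockNorm.ofBlocks (unitTorusGeo L k M) (blkFine L k M)) G
      (fun y y' => β * Real.exp (-(δ * tdistT M y y'))))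
    (hG' : HasMaj (BlockNorm.ofBlocks (unitTorusGeo L k M) (fun i : Tor (fine (L ^ m * L ^ k) M) × Fin (d + 1) => blockOf (L ^ m * L ^ k) M i.1))
      (BlockNorm.ofBlocks (unitTorusGeo L k M) (fun i : Tor (fine (L ^ m * L ^ k) M) × Fin (d + 1) => blockOf (L ^ m * L ^ k) M i.1)) G'
      (fun y y' => β * Real.exp (-(δ * tdistT M y y'))))
    (hDG : HasMaj (BlockNorm.ofBlocks (unitTorusGeo L k M) (blkFine L k M))
      (BlockNorm.ofBlocks (unitTorusGeo L k M) (fun i : Tor (fine (L ^ m * L ^ k) M) × Fin (d + 1) => blockOf (L ^ m * L ^ k) M i.1))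
      (idef (pull (kingPrV L k m M)) (pull (kingPrV L k m M)) G' G) (fun y y' => m₀ * θ * Real.exp (-(δ * tdistT M y y'))))
    (hG'div : ∀ κ : Fin (d + 1), HasMaj (BlockNorm.ofBlocks (unitTorusGeo L k M) (fun i : Tor (fine (L ^ m * L ^ k) M) × Fin (d + 1) => blockOf (L ^ m * L ^ k) M i.1))
      (BlockNorm.ofBlocks (unitTorusGeo L k M) (fun i : Tor (fine (L ^ m * L ^ k) M) × Fin (d + 1) => blockOf (L ^ m * L ^ k) M i.1))
      (G' ∘ₗ symbOp M (L ^ m * L ^ k) (((L ^ m * L ^ k : ℕ) : ℝ) • (sTinv M (L ^ m * L ^ k) κ - 1))) (fun y y' => C₁ * Real.exp (-(δ * tdistT M y y'))))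
    {c' : Tor (fine (L ^ m * L ^ k) M) × Fin (d + 1) → ℝ} (hreg : (coeffBgSup (Tor (fine (L ^ m * L ^ k) M) × Fin (d + 1)) Msz).Reg335 c35 α₀ c') :
    HasMaj (BlockNorm.ofBlocks (unitTorusGeo L k M) (blkFine L k M))
      (BlockNorm.ofBlocks (unitTorusGeo L k M) (fun i : Tor (fine (L ^ m * L ^ k) M) × Fin (d + 1) => blockOf (L ^ m * L ^ k) M i.1))
      (idef (pull (kingPrV L k m M)) (pull (kingPrV L k m M)) (bgProp G' c') (bgProp G (blockAvg (kingPrV L k m M) c')))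
      (fun y y' => supConst d β cr m₀ C₁ c35 a₀ * θ * Real.exp (-((δ - σ) * tdistT M y y'))) := by
  have hsup : ∀ x', |c' x'| ≤ c35 * Msz * α₀ := (reg335_coeffBgSup_iff _ Msz c35 α₀ c').1 hreg
  have hM0 : 0 ≤ Msz := zero_le_one.trans hM
  have hr0 : 0 ≤ c35 * Msz * α₀ := by positivity
  have hra : c35 * Msz * α₀ ≤ c35 * a₀ := by rw [mul_assoc]; exact mul_le_mul_of_nonneg_left hMα hc35.le
  have hq' : β * (c35 * Msz * α₀) * cr ≤ 1 / 2 := (mul_le_mul_of_nonneg_right (mul_le_mul_of_nonneg_left hra hβ) hcr).trans hq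
  have hq1 : β * (c35 * Msz * α₀) * cr < 1 := by linarith
  have hinv : (1 - β * (c35 * Msz * α₀) * cr)⁻¹ ≤ 2 := inv_one_sub_le_two hq'
  have hinv0 : 0 ≤ (1 - β * (c35 * Msz * α₀) * cr)⁻¹ := inv_nonneg.2 (by linarith)
  -- M-D at the rate `ρ = δ − σ`
  have key := hasMaj_idef_bgProp_of_divAdj M k m hσ hcr hrow (ρ := δ - σ) (by linarith) (by linarith) hβ hr0 hC₁ (mul_nonneg hm₀ hθ) hG hG' hDG hG'div hsup hq1
  refine key.mono fun a b => ?_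
  have hE : 0 ≤ Real.exp (-((δ - σ) * tdistT M a b)) := Real.exp_nonneg _
  refine mul_le_mul_of_nonneg_right ?_ hE
  rw [one_mul, one_mul]
  -- `(1 − q)⁻¹ ≤ 2`, `r ≤ c₃₅a₀`, `(L^k)⁻¹ ≤ θ`, `θ` factored out
  have hrc : c35 * Msz * α₀ * (β * (1 - β * (c35 * Msz * α₀) * cr)⁻¹) ≤ c35 * a₀ * (β * 2) :=
    mul_le_mul hra (mul_le_mul_of_nonneg_left hinv hβ) (mul_nonneg hβ hinv0) (by positivity)
  have h1 : m₀ * θ * cr * (c35 * Msz * α₀ * (β * (1 - β * (c35 * Msz * α₀) * cr)⁻¹)) ≤ m₀ * θ * cr * (c35 * a₀ * (β * 2)) :=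
    mul_le_mul_of_nonneg_left hrc (by positivity)
  have h2 : 2 * (d + 1) * (c35 * Msz * α₀) * (((L ^ k : ℕ) : ℝ))⁻¹ * C₁ * (β * (1 - β * (c35 * Msz * α₀) * cr)⁻¹) * cr ≤ 2 * (d + 1) * (c35 * a₀) * C₁ * (β * 2) * cr * θ := by
    calc 2 * (d + 1) * (c35 * Msz * α₀) * (((L ^ k : ℕ) : ℝ))⁻¹ * C₁ * (β * (1 - β * (c35 * Msz * α₀) * cr)⁻¹) * cr
        = (2 * ((d : ℝ) + 1) * C₁ * cr) * (c35 * Msz * α₀ * (β * (1 - β * (c35 * Msz * α₀) * cr)⁻¹)) * (((L ^ k : ℕ) : ℝ))⁻¹ := by ring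
      _ ≤ (2 * ((d : ℝ) + 1) * C₁ * cr) * (c35 * a₀ * (β * 2)) * θ :=
          mul_le_mul (mul_le_mul_of_nonneg_left hrc (by positivity)) hkθ (inv_nonneg.mpr (by positivity)) (by positivity)
      _ = 2 * (d + 1) * (c35 * a₀) * C₁ * (β * 2) * cr * θ := by ring
  have hsum0 : 0 ≤ m₀ * θ * cr + m₀ * θ * cr * (c35 * a₀ * (β * 2)) + 2 * (d + 1) * (c35 * a₀) * C₁ * (β * 2) * cr * θ := by positivity
  calc (m₀ * θ * cr + m₀ * θ * cr * (c35 * Msz * α₀ * (β * (1 - β * (c35 * Msz * α₀) * cr)⁻¹)) +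
          2 * (d + 1) * (c35 * Msz * α₀) * (((L ^ k : ℕ) : ℝ))⁻¹ * C₁ * (β * (1 - β * (c35 * Msz * α₀) * cr)⁻¹) * cr) * (1 - β * (c35 * Msz * α₀) * cr)⁻¹
      ≤ (m₀ * θ * cr + m₀ * θ * cr * (c35 * a₀ * (β * 2)) + 2 * (d + 1) * (c35 * a₀) * C₁ * (β * 2) * cr * θ) * 2 :=
        mul_le_mul (add_le_add (add_le_add le_rfl h1) h2) hinv hinv0 hsum0
    _ = supConst d β cr m₀ C₁ c35 a₀ * θ := by unfold supConst; ring

/-- ★★ **`EtaRateIneq342` PER INDEX, EXPLICIT CONSTANTS, NO OSCILLATION LETTER.**  Data of `hasMaj_entry0_supOnly` with `σ < δ`, size field `M_sz` on the sized carrier, a rate exponent `γ`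
with `θ ≤ (L^k)^{−γ}`, and entries 1–3 operators with majorants `B₃·θ·e^{−ρ₃d}` (`B₃ ≥ 0`, `ρ₃ > 0`): for every configuration `c′` regular in the sense of the SUP LETTER at `(c₃₅, α₀)` under
the guard, the realised kernel family satisfies `EtaRateIneq342 … (max supConst B₃) (min (δ−σ) ρ₃) γ c′`. [cite: Balaban1985BackgroundPropagators, Thm 3.1 (3.42) p.397 (shape)] -/
theorem etaRateIneq342_supOnly {σ cr : ℝ} (hσ : 0 ≤ σ) (hcr : 0 ≤ cr) (hrow : RowSum (unitTorusGeo L k M) σ cr) {Msz δ β m₀ θ C₁ c35 a₀ α₀ γ B₃ ρ₃ : ℝ}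
    (hσδ : σ ≤ δ) (hβ : 0 ≤ β) (hm₀ : 0 ≤ m₀) (hθ : 0 ≤ θ) (hkθ : (((L ^ k : ℕ) : ℝ))⁻¹ ≤ θ) (hθγ : θ ≤ ((L : ℝ) ^ k) ^ (-γ)) (hC₁ : 0 ≤ C₁) (hc35 : 0 < c35)
    (ha₀ : 0 ≤ a₀) (hq : β * (c35 * a₀) * cr ≤ 1 / 2) (hM : 1 ≤ Msz) (hα₀ : 0 < α₀) (hMα : Msz * α₀ ≤ a₀) (hB₃ : 0 ≤ B₃)
    {G : (Tor (fine (L ^ k) M) × Fin (d + 1) → ℝ) →ₗ[ℝ] (Tor (fine (L ^ k) M) × Fin (d + 1) → ℝ)}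
    {G' : (Tor (fine (L ^ m * L ^ k) M) × Fin (d + 1) → ℝ) →ₗ[ℝ] (Tor (fine (L ^ m * L ^ k) M) × Fin (d + 1) → ℝ)}
    {T : Fin 3 → (Tor (fine (L ^ m * L ^ k) M) × Fin (d + 1) → ℝ) → ((Tor (fine (L ^ k) M) × Fin (d + 1) → ℝ) →ₗ[ℝ] (Tor (fine (L ^ m * L ^ k) M) × Fin (d + 1) → ℝ))}
    (hG : HasMaj (BlockNorm.ofBlocks (unitTorusGeo L k M) (blkFine L k M)) (BlockNorm.ofBlocks (unitTorusGeo L k M) (blkFine L k M)) G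
      (fun y y' => β * Real.exp (-(δ * tdistT M y y'))))
    (hG' : HasMaj (BlockNorm.ofBlocks (unitTorusGeo L k M) (fun i : Tor (fine (L ^ m * L ^ k) M) × Fin (d + 1) => blockOf (L ^ m * L ^ k) M i.1))
      (BlockNorm.ofBlocks (unitTorusGeo L k M) (fun i : Tor (fine (L ^ m * L ^ k) M) × Fin (d + 1) => blockOf (L ^ m * L ^ k) M i.1)) G'
      (fun y y' => β * Real.exp (-(δ * tdistT M y y'))))
    (hDG : HasMaj (BlockNorm.ofBlocks (unitTorusGeo L k M) (blkFine L k M))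
      (BlockNorm.ofBlocks (unitTorusGeo L k M) (fun i : Tor (fine (L ^ m * L ^ k) M) × Fin (d + 1) => blockOf (L ^ m * L ^ k) M i.1))
      (idef (pull (kingPrV L k m M)) (pull (kingPrV L k m M)) G' G) (fun y y' => m₀ * θ * Real.exp (-(δ * tdistT M y y'))))
    (hG'div : ∀ κ : Fin (d + 1), HasMaj (BlockNorm.ofBlocks (unitTorusGeo L k M) (fun i : Tor (fine (L ^ m * L ^ k) M) × Fin (d + 1) => blockOf (L ^ m * L ^ k) M i.1))
      (BlockNorm.ofBlocks (unitTorusGeo L k M) (fun i : Tor (fine (L ^ m * L ^ k) M) × Fin (d + 1) => blockOf (L ^ m * L ^ k) M i.1))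
      (G' ∘ₗ symbOp M (L ^ m * L ^ k) (((L ^ m * L ^ k : ℕ) : ℝ) • (sTinv M (L ^ m * L ^ k) κ - 1))) (fun y y' => C₁ * Real.exp (-(δ * tdistT M y y'))))
    {c' : Tor (fine (L ^ m * L ^ k) M) × Fin (d + 1) → ℝ} (hreg : (coeffBgSup (Tor (fine (L ^ m * L ^ k) M) × Fin (d + 1)) Msz).Reg335 c35 α₀ c')
    (hT : ∀ n : Fin 3, HasMaj (BlockNorm.ofBlocks (unitTorusGeo L k M) (blkFine L k M))
      (BlockNorm.ofBlocks (unitTorusGeo L k M) (fun i : Tor (fine (L ^ m * L ^ k) M) × Fin (d + 1) => blockOf (L ^ m * L ^ k) M i.1)) (T n c')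
      (fun y y' => B₃ * θ * Real.exp (-(ρ₃ * tdistT M y y')))) :
    EtaRateIneq342 (opFamily (g := unitTorusGeoS L k M Msz) (B := coeffBgSup (Tor (fine (L ^ m * L ^ k) M) × Fin (d + 1)) Msz) (blkFine L k M)
      (blkFine L k M ∘ kingPrV L k m M) (bgOps (kingPrV L k m M) G G' T)) (max (supConst d β cr m₀ C₁ c35 a₀) B₃) (min (δ - σ) ρ₃) γ c' := by
  have h0 := hasMaj_entry0_supOnly M k m hσ hcr hrow hσδ hβ hm₀ hθ hkθ hC₁ hc35 ha₀ hq hM hα₀ hMα hG hG' hDG hG'div hreg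
  have hC0 : 0 ≤ supConst d β cr m₀ C₁ c35 a₀ := supConst_nonneg hβ hcr hm₀ hC₁ hc35.le ha₀
  have hB₀ : 0 ≤ max (supConst d β cr m₀ C₁ c35 a₀) B₃ := hC0.trans (le_max_left _ _)
  have hLr : (0 : ℝ) < (L : ℝ) := by exact_mod_cast Nat.pos_of_ne_zero (NeZero.ne L)
  have hη : 0 < (unitTorusGeoS L k M Msz).eta := inv_pos.mpr (pow_pos hLr _)
  have hblk : blkFine L k M ∘ kingPrV L k m M = fun i : Tor (fine (L ^ m * L ^ k) M) × Fin (d + 1) => blockOf (L ^ m * L ^ k) M i.1 := blkFine_comp_kingPrV M L k m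
  rw [hblk]
  refine etaRateIneq342_of_hasMaj (g := unitTorusGeoS L k M Msz) (B := coeffBgSup (Tor (fine (L ^ m * L ^ k) M) × Fin (d + 1)) Msz) (blkFine L k M)
    (fun i : Tor (fine (L ^ m * L ^ k) M) × Fin (d + 1) => blockOf (L ^ m * L ^ k) M i.1) hη.le hLr.le hB₀ (bgOps (kingPrV L k m M) G G' T) c' fun n => ?_
  -- the common domination: `B·θ·e^{−ρd} ≤ B₀·pref4·e^{−δ₀d}·max(rf y, rf y′)` for `B ≤ B₀`, `δ₀ ≤ ρ`
  have hdom : ∀ {B ρ : ℝ}, 0 ≤ B → B ≤ max (supConst d β cr m₀ C₁ c35 a₀) B₃ → min (δ - σ) ρ₃ ≤ ρ → ∀ y y' : Tor M,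
      B * θ * Real.exp (-(ρ * tdistT M y y')) ≤
        max (supConst d β cr m₀ C₁ c35 a₀) B₃ * B9.pref4 ((opGeo (unitTorusGeoS L k M Msz) (Tor (fine (L ^ k) M) × Fin (d + 1)) (blkFine L k M)).len y) n *
          Real.exp (-(min (δ - σ) ρ₃ * (unitTorusGeoS L k M Msz).dist y y')) *
          max (rateFactor (opGeo (unitTorusGeoS L k M Msz) (Tor (fine (L ^ k) M) × Fin (d + 1)) (blkFine L k M)) γ y)
            (rateFactor (opGeo (unitTorusGeoS L k M Msz) (Tor (fine (L ^ k) M) × Fin (d + 1)) (blkFine L k M)) γ y') := by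
    intro B ρ hB0 hB hρ y y'
    have hlen : 1 ≤ (unitTorusGeoS L k M Msz).len y := by
      show (1 : ℝ) ≤ (L : ℝ) ^ k * (((L : ℝ) ^ k)⁻¹)
      rw [mul_inv_cancel₀ (pow_ne_zero _ hLr.ne')]
    have hpref : 1 ≤ B9.pref4 ((opGeo (unitTorusGeoS L k M Msz) (Tor (fine (L ^ k) M) × Fin (d + 1)) (blkFine L k M)).len y) n := by
      rw [opGeo_len]; exact one_le_pref4 hlen n
    have hexp : Real.exp (-(ρ * tdistT M y y')) ≤ Real.exp (-(min (δ - σ) ρ₃ * (unitTorusGeoS L k M Msz).dist y y')) :=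
      Real.exp_le_exp.mpr (neg_le_neg (mul_le_mul_of_nonneg_right hρ (tdistT_nonneg M y y')))
    have hrf : θ ≤ max (rateFactor (opGeo (unitTorusGeoS L k M Msz) (Tor (fine (L ^ k) M) × Fin (d + 1)) (blkFine L k M)) γ y)
        (rateFactor (opGeo (unitTorusGeoS L k M Msz) (Tor (fine (L ^ k) M) × Fin (d + 1)) (blkFine L k M)) γ y') := by
      rw [rateFactor_opGeo (unitTorusGeoS L k M Msz) _ (blkFine L k M) hη.ne' hLr γ y', rateWeight_unitTorusGeoS]
      exact hθγ.trans (le_max_right _ _)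
    have hE : 0 ≤ Real.exp (-(min (δ - σ) ρ₃ * (unitTorusGeoS L k M Msz).dist y y')) := Real.exp_nonneg _
    calc B * θ * Real.exp (-(ρ * tdistT M y y'))
        ≤ (max (supConst d β cr m₀ C₁ c35 a₀) B₃ * B9.pref4 ((opGeo (unitTorusGeoS L k M Msz) (Tor (fine (L ^ k) M) × Fin (d + 1)) (blkFine L k M)).len y) n) * θ *
            Real.exp (-(min (δ - σ) ρ₃ * (unitTorusGeoS L k M Msz).dist y y')) := by
          refine mul_le_mul (mul_le_mul_of_nonneg_right ?_ hθ) hexp (Real.exp_nonneg _) (mul_nonneg (mul_nonneg hB₀ (zero_le_one.trans hpref)) hθ)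
          calc B = B * 1 := (mul_one B).symm
            _ ≤ _ := mul_le_mul hB hpref zero_le_one hB₀
      _ = max (supConst d β cr m₀ C₁ c35 a₀) B₃ * B9.pref4 ((opGeo (unitTorusGeoS L k M Msz) (Tor (fine (L ^ k) M) × Fin (d + 1)) (blkFine L k M)).len y) n *
            Real.exp (-(min (δ - σ) ρ₃ * (unitTorusGeoS L k M Msz).dist y y')) * θ := by ring
      _ ≤ _ := mul_le_mul_of_nonneg_left hrf (mul_nonneg (mul_nonneg hB₀ (zero_le_one.trans hpref)) hE)
  fin_cases n
  · exact h0.mono (hdom hC0 (le_max_left _ _) (min_le_left _ _))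
  · exact (hT 0).mono (hdom hB₃ (le_max_right _ _) (min_le_right _ _))
  · exact (hT 1).mono (hdom hB₃ (le_max_right _ _) (min_le_right _ _))
  · exact (hT 2).mono (hdom hB₃ (le_max_right _ _) (min_le_right _ _))

end PerIndex

/-! ## §12 ★★★ The node's first conjunct BY NAME over the sup-only carrier — background block LIVE, size guard LIVE, (3.35) = its sup letter -/

section Node

variable {L : ℕ} [NeZero L] {I : Type} (Mf : I → Fin (d + 1) → ℕ) [∀ i μ, NeZero (Mf i μ)] (kk mm : I → ℕ) (Msz θ : I → ℝ)
  (G : ∀ i, (Tor (fine (L ^ kk i) (Mf i)) × Fin (d + 1) → ℝ) →ₗ[ℝ] (Tor (fine (L ^ kk i) (Mf i)) × Fin (d + 1) → ℝ))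
  (G' : ∀ i, (Tor (fine (L ^ mm i * L ^ kk i) (Mf i)) × Fin (d + 1) → ℝ) →ₗ[ℝ] (Tor (fine (L ^ mm i * L ^ kk i) (Mf i)) × Fin (d + 1) → ℝ))
  (T : ∀ i, Fin 3 → (Tor (fine (L ^ mm i * L ^ kk i) (Mf i)) × Fin (d + 1) → ℝ) →
    ((Tor (fine (L ^ kk i) (Mf i)) × Fin (d + 1) → ℝ) →ₗ[ℝ] (Tor (fine (L ^ mm i * L ^ kk i) (Mf i)) × Fin (d + 1) → ℝ)))

/-- ★★★ **NE2⁺, OPERATOR LAYER — `T4EtaRate.NE2PlusOperator` BY NAME OVER THE SUP-ONLY CARRIER, BACKGROUND BLOCK LIVE, SIZE GUARD LIVE.**  For ANY family of King-torus data (unit tori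
`M_i`, coarse scales `k_i`, refinements `m_i`, size fields `M_sz,i`, rate numbers `(L^{k_i})⁻¹ ≤ θ_i ≤ (L^{k_i})^{−γ}`) with UNIFORM letters — the (2.61) row sum `(σ, c_r)`; `U ≡ 1` pieces
`G_i, G′_i ≤ β·e^{−δd}` (`σ < δ`), η-defects `𝔇(G′_i, G_i) ≤ m₀θ_i·e^{−δd}`, fine source-divergence letters `G′_i∘ρ′(n′(s_κ⁻¹−1)) ≤ C₁·e^{−δd}` (every `κ`); entries 1–3 operators with
majorants `B₃θ_i·e^{−ρ₃d}` (`ρ₃ > 0`) — and `c₃₅ > 0`: the realised paired instances over the SUP-ONLY carriers and their kernel families (entry 0 = the CONSTRUCTED background-dependent pair)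
satisfy `NE2PlusOperator c₃₅`, with `M₅ = 1`, `a₀ = (2c₃₅(βc_r + 1))⁻¹`, `B₀ = max(supConst, B₃) + 1`, `δ₀ = min(δ − σ, ρ₃)`, exponent `γ`.  (3.35) is consumed AS ITS SUP LETTER ONLY; the
guard `M·α₀ ≤ a₀` supplies the Neumann contraction; NO oscillation letter anywhere — n15-b `ne2PlusOperator_background` with `FibreOsc` struck, paid for by the «G∇*» letters.
[cite: Balaban1985BackgroundPropagators, Thm 3.1 p.397 (quantifier template), (3.35) p.396, (3.42) p.397, (3.62)–(3.65) pp.402–403 (shapes, mechanism); Balaban1984PropagatorsI, Prop. 1.2 (1.110)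
p.35 («G∇*J», shape); King1986, Prop. 3.9 (3.73) p.665 (rate factor)] -/
theorem ne2PlusOperator_supOnly (c35 : ℝ) (hc35 : 0 < c35) {σ cr : ℝ} (hσ : 0 ≤ σ) (hcr : 0 ≤ cr) (hrow : ∀ i, RowSum (unitTorusGeo L (kk i) (Mf i)) σ cr)
    {δ β m₀ γ C₁ B₃ ρ₃ : ℝ} (hσδ : σ < δ) (hβ : 0 ≤ β) (hm₀ : 0 ≤ m₀) (hγ : 0 < γ) (hC₁ : 0 ≤ C₁) (hB₃ : 0 ≤ B₃) (hρ₃ : 0 < ρ₃) (hθ : ∀ i, 0 ≤ θ i)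
    (hkθ : ∀ i, (((L ^ kk i : ℕ) : ℝ))⁻¹ ≤ θ i) (hθγ : ∀ i, θ i ≤ ((L : ℝ) ^ kk i) ^ (-γ))
    (hG : ∀ i, HasMaj (BlockNorm.ofBlocks (unitTorusGeo L (kk i) (Mf i)) (blkFine L (kk i) (Mf i))) (BlockNorm.ofBlocks (unitTorusGeo L (kk i) (Mf i)) (blkFine L (kk i) (Mf i))) (G i)
      (fun y y' => β * Real.exp (-(δ * tdistT (Mf i) y y'))))
    (hG' : ∀ i, HasMaj (BlockNorm.ofBlocks (unitTorusGeo L (kk i) (Mf i)) (fun z : Tor (fine (L ^ mm i * L ^ kk i) (Mf i)) × Fin (d + 1) => blockOf (L ^ mm i * L ^ kk i) (Mf i) z.1))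
      (BlockNorm.ofBlocks (unitTorusGeo L (kk i) (Mf i)) (fun z : Tor (fine (L ^ mm i * L ^ kk i) (Mf i)) × Fin (d + 1) => blockOf (L ^ mm i * L ^ kk i) (Mf i) z.1)) (G' i)
      (fun y y' => β * Real.exp (-(δ * tdistT (Mf i) y y'))))
    (hDG : ∀ i, HasMaj (BlockNorm.ofBlocks (unitTorusGeo L (kk i) (Mf i)) (blkFine L (kk i) (Mf i)))
      (BlockNorm.ofBlocks (unitTorusGeo L (kk i) (Mf i)) (fun z : Tor (fine (L ^ mm i * L ^ kk i) (Mf i)) × Fin (d + 1) => blockOf (L ^ mm i * L ^ kk i) (Mf i) z.1))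
      (idef (pull (kingPrV L (kk i) (mm i) (Mf i))) (pull (kingPrV L (kk i) (mm i) (Mf i))) (G' i) (G i)) (fun y y' => m₀ * θ i * Real.exp (-(δ * tdistT (Mf i) y y'))))
    (hG'div : ∀ i (κ : Fin (d + 1)), HasMaj (BlockNorm.ofBlocks (unitTorusGeo L (kk i) (Mf i)) (fun z : Tor (fine (L ^ mm i * L ^ kk i) (Mf i)) × Fin (d + 1) => blockOf (L ^ mm i * L ^ kk i) (Mf i) z.1))
      (BlockNorm.ofBlocks (unitTorusGeo L (kk i) (Mf i)) (fun z : Tor (fine (L ^ mm i * L ^ kk i) (Mf i)) × Fin (d + 1) => blockOf (L ^ mm i * L ^ kk i) (Mf i) z.1))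
      (G' i ∘ₗ symbOp (Mf i) (L ^ mm i * L ^ kk i) (((L ^ mm i * L ^ kk i : ℕ) : ℝ) • (sTinv (Mf i) (L ^ mm i * L ^ kk i) κ - 1))) (fun y y' => C₁ * Real.exp (-(δ * tdistT (Mf i) y y'))))
    (hT : ∀ i (c' : Tor (fine (L ^ mm i * L ^ kk i) (Mf i)) × Fin (d + 1) → ℝ) (n : Fin 3), HasMaj (BlockNorm.ofBlocks (unitTorusGeo L (kk i) (Mf i)) (blkFine L (kk i) (Mf i)))
      (BlockNorm.ofBlocks (unitTorusGeo L (kk i) (Mf i)) (fun z : Tor (fine (L ^ mm i * L ^ kk i) (Mf i)) × Fin (d + 1) => blockOf (L ^ mm i * L ^ kk i) (Mf i) z.1)) (T i n c')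
      (fun y y' => B₃ * θ i * Real.exp (-(ρ₃ * tdistT (Mf i) y y')))) :
    NE2PlusOperator c35 (fun i => bgInstanceSup (L := L) (Mf i) (kk i) (mm i) (Msz i)) (fun i => bgFamilySup (L := L) (Mf i) (kk i) (mm i) (Msz i) (G i) (G' i) (T i)) := by
  -- the guard constant: `β·(c₃₅a₀)·c_r ≤ ½`
  set a₀ : ℝ := (2 * c35 * (β * cr + 1))⁻¹ with ha₀_def
  have hden : 0 < 2 * c35 * (β * cr + 1) := by positivity
  have ha₀ : 0 < a₀ := inv_pos.2 hden
  have hq : β * (c35 * a₀) * cr ≤ 1 / 2 := by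
    have h1 : β * (c35 * a₀) * cr = (β * cr) * (c35 * a₀) := by ring
    have h2 : c35 * a₀ = (2 * (β * cr + 1))⁻¹ := by rw [ha₀_def]; field_simp
    rw [h1, h2, ← div_eq_mul_inv, div_le_iff₀ (by positivity)]
    nlinarith [mul_nonneg hβ hcr]
  have hC0 : 0 ≤ supConst d β cr m₀ C₁ c35 a₀ := supConst_nonneg hβ hcr hm₀ hC₁ hc35.le ha₀.le
  refine ⟨1, min (δ - σ) ρ₃, a₀, max (supConst d β cr m₀ C₁ c35 a₀) B₃ + 1, γ, one_pos, lt_min (by linarith) hρ₃, ha₀,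
    lt_of_lt_of_le one_pos (le_add_of_nonneg_left (hC0.trans (le_max_left _ _))), hγ, fun i hM α₀ hα₀ hMα c' hreg => ?_⟩
  have hM' : 1 ≤ Msz i := hM
  have hMα' : Msz i * α₀ ≤ a₀ := hMα
  have key := etaRateIneq342_supOnly (L := L) (Mf i) (kk i) (mm i) hσ hcr (hrow i) hσδ.le hβ hm₀ (hθ i) (hkθ i) (hθγ i) hC₁ hc35 ha₀.le hq hM' hα₀ hMα' hB₃
    (hG i) (hG' i) (hDG i) (hG'div i) hreg (hT i c')
  have hLr : (0 : ℝ) < (L : ℝ) := by exact_mod_cast Nat.pos_of_ne_zero (NeZero.ne L)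
  -- `EtaRateIneq342` is monotone in `B₀` (`B₀ ↦ B₀ + 1`, a strictly positive display)
  intro n lam y y' hs
  refine (key n lam y y' hs).trans ?_
  have hlen : 1 ≤ (unitTorusGeoS L (kk i) (Mf i) (Msz i)).len y := by
    show (1 : ℝ) ≤ (L : ℝ) ^ kk i * (((L : ℝ) ^ kk i)⁻¹)
    rw [mul_inv_cancel₀ (pow_ne_zero _ hLr.ne')]
  have hpref : 0 ≤ B9.pref4 ((bgInstanceSup (L := L) (Mf i) (kk i) (mm i) (Msz i)).gc.len y) n := by
    have : 1 ≤ B9.pref4 ((opGeo (unitTorusGeoS L (kk i) (Mf i) (Msz i)) (Tor (fine (L ^ kk i) (Mf i)) × Fin (d + 1)) (blkFine L (kk i) (Mf i))).len y) n := by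
      rw [opGeo_len]; exact one_le_pref4 hlen n
    exact zero_le_one.trans this
  have hη : 0 < (unitTorusGeoS L (kk i) (Mf i) (Msz i)).eta := inv_pos.mpr (pow_pos hLr _)
  have hrf : 0 ≤ max (rateFactor (bgInstanceSup (L := L) (Mf i) (kk i) (mm i) (Msz i)).gc γ y) (rateFactor (bgInstanceSup (L := L) (Mf i) (kk i) (mm i) (Msz i)).gc γ y') :=
    (T4EtaRate.rateFactor_nonneg (g := opGeo (unitTorusGeoS L (kk i) (Mf i) (Msz i)) (Tor (fine (L ^ kk i) (Mf i)) × Fin (d + 1)) (blkFine L (kk i) (Mf i))) hη.le hLr.le γ y).trans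
      (le_max_left _ _)
  have hnorm : 0 ≤ (bgInstanceSup (L := L) (Mf i) (kk i) (mm i) (Msz i)).gc.supNorm lam := Real.iSup_nonneg fun x => abs_nonneg _
  have hE : 0 ≤ Real.exp (-(min (δ - σ) ρ₃ * (bgInstanceSup (L := L) (Mf i) (kk i) (mm i) (Msz i)).gc.dist y y')) := Real.exp_nonneg _
  exact mul_le_mul_of_nonneg_right (mul_le_mul_of_nonneg_right (mul_le_mul_of_nonneg_right
    (mul_le_mul_of_nonneg_right (le_add_of_nonneg_right zero_le_one) hpref) hE) hrf) hnorm

end Node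

end Summit.QuantumFields.YangMills.BalabanUVNodes.N15.TwoGrid

end
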